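import Summits.QuantumFields.QCD.Theses.GaussianLinkFrames
import Summits.QuantumFields.QCD.Theorems.GaussianLinkFramesFrameAPrioriBoundOfMeanSquare
import Summits.QuantumFields.QCD.Theorems.GaussianLinkFramesFrameAPrioriBoundStubBlindVanish
import Summits.QuantumFields.QCD.Theorems.GaussianLinkFramesFrameAPrioriBoundStubMeanSquareOfNonreal
import Summits.QuantumFields.QCD.Theorems.GaussianLinkFramesFrameAPrioriBoundStubPortReduction

/-!
# Crux `FrameAPrioriBound` (stmt-QuantumFields-17374) — line `cube-cofactor`
(crux-strategist planner-cstrat-stmt-QuantumFields-17374-b1-0, 2026-08-17)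

**Idea.**  The crux is an Aizenman–Molchanov a-priori fractional-moment bound for the Hermitian
Wilson–Dirac kernel `H(U) = γ₅ D_W(U; m₀, r = 1)` under a PRODUCT tilted-Haar law on the `SU(3)`
links.  The route review (refuter rreview-0817T01-3) killed the birth line's single-star cut: by
gauge covariance the star Schur complement does not see the 8 star links whenever the neighbour
block of the punctured resolvent is colour-trivial, so no sup-over-background local averaging over a
star (the Aizenman–Molchanov architecture) can work; and the sibling crux
`PauliWegnerSea.FibreCofactorDomination` (two-star fibre) is hostage to REALISABLE semi-dark port
data (Cruxes/FibreCofactorDomination/DarkLeafTaxonomy.md §§2–7).  The present line uses the one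
freedom this crux has and the sibling has not: since the law is a product over ALL links, the
re-sampled region may be chosen.  We re-sample every link touching the axis-parallel cubes
`Q₂(x) ∪ Q₂(y)` (ℓ^∞-radius 2).  In a cube every site has interior links along all four axes, so
(i) no configuration-independent ("blind") kernel vector exists at any outer site (two
anticommuting `γ`'s), which removes the tip mechanism that makes every ℓ¹-ball fibre abstractly
semi-dark, (ii) the chiral-cut count of the sibling taxonomy (§7: a cut kernel needs
`#outer sites > #co-tree links`) FAILS for cubes (`544 < 1376` for `Q₂`, `80 < 136` for `Q₁`), and
(iii) radius 2 keeps the centre `x` two layers away from the port self-energy, so the Dirichlet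
CAVITY mechanism (full elimination of the port-coupled space; for `Q₁` it isolates `x` with the
inward halves of its neighbours, a link-free resonant cavity) can only produce kernels INVISIBLE at
`x, y` (e.g. at the 16 corners), which do not enter the `(x,y)` cofactor block to leading order.  The
exterior enters the cube Green function only through a dissipative port matrix, which is
COMPACTIFIED (Cayley transform: contractions on the port space); on the compact abstract family the
statement "no `x`- or `y`-visible semi-dark point, and cofactor order ≥ determinant order at the
invisible ones" is real algebraic geometry about ONE fixed matrix pencil, and compactness turns it
into the uniform cofactor domination `stub_cubeCofactorDomination` below — realisability-free and
uniform in the volume for free.  Fractional moments then follow from a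
uniform Remez-type relative small-ball inequality for the bounded-degree polynomial
`W ↦ det(H(refit W) − z)` on `SU(3)^n` (`stub_cubeSmallBall`, the tree's TiltedFlatness (b′) /
SingleLinkLogFlatness technology), a layer-cake assembly (`stub_fibreMoment`), single-link flatness
of the tilt (`stub_tiltTransfer`, polynomial loss `(C(1+B)^p)^n`, `n ≤ 6000` links) and Fubini for
the product law (`stub_conditioning`).

**Disproof used.** No `Disproof.lean` exists yet for this crux (2026-08-17T08:30Z).  The line honours
the refuter's review finding (FrameAPrioriBound_review.md §3): it never averages over a star or a
tree-supported link set with the background frozen — the re-sampled region is plaquette-rich and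
the background is not frozen but compactified.

Stubs: `stub_cubeSmallBall` (L), `stub_cubeCofactorDomination` (X — load-bearing),
`stub_fibreMoment` (M), `stub_tiltTransfer` (M), `stub_conditioning` (M); the implication
`cruxStatement_of_stubs` (stub statements ⇒ crux) is sorry-free, and `FrameAPrioriBound_of` applies
it to the declared stubs and concludes the crux by name.

**Lead's reshape (prover-line-stmt-QuantumFields-17374-0, 2026-08-17, cycle 1).** Same composition,
same five stubs; two M-stubs restated in the ABSTRACT form the tree's machinery proves directly:
`stub_tiltTransfer` is now the ball-free UNTILT for an arbitrary non-negative `F` on the fibre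
(`∫ F ≤ M ⇒ ∫ F·tiltWt / ∫ tiltWt ≤ C(1+B)^p M`, from `CircleTransport.stub_circleUntilt` with the
`≤ 10⁴` touched links listed and the linear tilt `(1+B)`-rescaled to a `B`-free Lipschitz action), and
`stub_conditioning` carries the hypothesis `Measurable F` (the composition supplies measurability of
the concrete integrand `V ↦ (Σ|((H(V) − z)⁻¹)_{xy}|)^s`, proved from `Matrix.inv_def`).

**State at the end of lead cycle 1 (2026-08-17 ~16:30Z).**  LANDED: LineDefs (p165929), `stub_cubeSmallBall`
(p166597), `stub_fibreMoment` (p166892), `stub_tiltTransfer` (p167682), `stub_conditioning` (p168158);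
the load-bearing `stub_cubeCofactorDomination` was split into `stub_cubeAdjugateNikolskii` (LANDED
p168939) + `stub_cubeMeanSquareDomination` (OPEN, the `L²` normal form of the crux's content) with the
sorry-free glue `cubeCofactorDomination_of_meanSquare`; the whole composition is LANDED as the
registered reduction stub `frameAPrioriBound_of_cubeMeanSquareDomination`
(`Theorems/GaussianLinkFramesFrameAPrioriBoundOfMeanSquare.lean`, p169125).  This skeleton is therefore
two declarations: the one open stub and the one-line composition.  Sorries: 1.

**Lead c1 reshape (prover-line-stmt-QuantumFields-17374-c1-0, 2026-08-17, cycle 2).**  Same composition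
(`frameAPrioriBound_of_cubeMeanSquareDomination`, landed p169125); the open stub (MS) is now ASSEMBLED from
four registered stubs along the structure any proof must have:
* `stub_blindVanish` (M) — RIGIDITY AT ORDER ZERO: a vector annihilated by every variation of the
  re-sampled links (`(H(refit W) − H(refit W')) h = 0` for all `W, W'`) vanishes identically on
  `Q₂(x) ∪ Q₂(y)` (each cube site `c` carries the touched links `(c, μ)` and `(c − μ̂, μ)`, whose
  `SU(3)`-variations force `(1 + γ_μ) h(c) = 0` and `(1 − γ_μ) h(c) = 0`).  Consequence: every
  `W`-INDEPENDENT robust eigenvector of the fibre family (an exact exterior flat band, the only dark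
  data known to exist) is invisible at the centres — mechanism (a) of the line card excluded for the
  real region including its port links, and the base case of the robust-kernel rigidity programme.
* `stub_meanSquareOfNonreal` (M) — REAL `z` BY CONTINUITY: (MS) for `Im z ≠ 0` with a uniform constant
  implies (MS) for all `|z| ≤ 1` (both sides are continuous in `z`: parametric integrals of continuous
  integrands over the compact fibre; `z_n = (1 − 1/(n+2)) z + i/(n+2)²` stays in the closed unit disc).
  So the load-bearing statement may assume `Im z ≠ 0`, where `adj/det` is the honest resolvent of the
  Hermitian `H(refit W)` and `Im ⟨v, (H − z) v⟩ = −Im z ‖v‖²` is available.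
* `stub_portReduction` (M) — PORT REDUCTION: for `Im z ≠ 0`, `det(H(refit W) − z) = c · det 𝕄(W)` and
  `adj(…)_{xy} = c · adj 𝕄(W)_{xy}` for every `W`, with `c ≠ 0` and `𝕄(W)` = the fibre matrix cut to
  the endpoints `Λ` of the touched links (identity-padded) minus a `W`-independent, `∂`-supported,
  dissipative port matrix `Σ` (two-star pattern `RandomRefit.det_wilsonDirac_twoStar_schur`).
* `stub_cubeMeanSquareDominationNonreal` (X, the lead's) — (MS) for `Im z ≠ 0`, GIVEN order-zero
  rigidity and the port reduction.  Its content (lead c1 analysis, NOTES/HANDOFF): by port reduction and curve selection it is an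
  ARC-WISE ORDER COMPARISON at the dark data of the compactified cube pencil — along every analytic arc of
  port data ending at a dark datum, the first `W`-NON-CONSTANT Taylor coefficient of the robust eigenvalue
  branch must occur no later than the order of the leakage product `ψ_W(x) ψ_W(y)†`; order zero is
  `stub_blindVanish`, order two is the rigidity "a `W`-constant port matrix element
  `⟨g, 𝕄₀(W)⁺ g⟩` forces zero transmission `(𝕄₀(W)⁺ g)(x)`".
Sorries after the c1 wave (19:35Z): 1 — `stub_blindVanish` (p173347), `stub_meanSquareOfNonreal` (p172803) and
`stub_portReduction` (p173332) LANDED and are imported; only `stub_cubeMeanSquareDominationNonreal` is open.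
`cubeMeanSquareDomination` and `FrameAPrioriBound_of` are real terms.
-/

noncomputable section

namespace Summit.QuantumFields.QCD.Cruxes.FrameAPrioriBound.CubeCofactor

open scoped BigOperators Matrix
open MeasureTheory Filter Literature.MathematicalPhysics.QuantumFieldTheory
  Literature.MathematicalPhysics.QuantumLattice Literature.Probability.LatticeModels

/-! STUB `blindVanish` — LANDED (p173347, `Theorems/GaussianLinkFramesFrameAPrioriBoundStubBlindVanish.lean`:
one-link variations by `Function.update`, `γ₅² = 1`, central/sign elements of `SU(3)`); imported. -/

/-! STUB `meanSquareOfNonreal` — LANDED (p172803, `Theorems/GaussianLinkFramesFrameAPrioriBoundStubMeanSquareOfNonreal.lean`: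
`continuous_parametric_integral_of_continuous` over the compact fibre, `z_n = (1 − 1/(n+1)) z + i/(n+1)²`); imported. -/

/-! STUB `portReduction` — LANDED (p173332, `Theorems/GaussianLinkFramesFrameAPrioriBoundStubPortReduction.lean`:
abstract `PortReduction.exists_portReduction` for any Hermitian `H`, `Im z ≠ 0`, predicate `Λ`; `sumCompl`/`fromBlocks`,
`det_fromBlocks₂₂`, `adjugate_fromBlocks_inl_inl`, dissipativity `Im z · Im⟨v, S v⟩ = (Im z)² ‖E⁻¹ Bᴴ v‖²`); imported. -/

/-- STUB `cubeMeanSquareDominationNonreal` (LOAD-BEARING, size X — the crux's open content; the lead's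
stub).  GIVEN order-zero rigidity (`stub_blindVanish`'s statement) and the port reduction
(`stub_portReduction`'s statement), mean-square cofactor domination on
the two-cube fibre for `Im z ≠ 0`, `|z| ≤ 1`, uniformly in `L ≥ 4`, `m₀ ∈ [−2,2]`, `x, y`, `U`:
`E_W (Σ|adj(H(refit W) − z)_{xy}|)² ≤ C₂ · E_W |det(H(refit W) − z)|²`.  Off the real axis both sides are
positive (`H` Hermitian) and the inequality is quantitative; its difficulty is the approach `Im z → 0`
near DARK port data (exact exterior flat bands: `det → 0` on the whole fibre).  Structure of any proof
(lead c1): port reduction `det = det(H_ext − z) · det 𝕄(W)`, `adj_xy = det(H_ext − z) · adj 𝕄(W)_xy`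
(pattern `RandomRefit.det_wilsonDirac_twoStar_schur` with `P := Q₃(x) ∪ Q₃(y)`), Cayley
compactification of the dissipative port datum, curve selection on the compact family ⇒ ARC-WISE ORDER
COMPARISON at each dark datum; by `z`-retuning the adversary cancels every `W`-CONSTANT Taylor
coefficient of the robust eigenvalue branch `λ(W,t)`, so the statement is: the first `W`-non-constant
coefficient `λ_k(W)` has `k ≤ ord_t ψ(x) + ord_t ψ(y)` (leakage orders of the branch eigenvector).
Order 0: the hypothesis.  Order 2 (the next obligation, finite-dimensional, star-free): for a dark
pencil `𝕄₀(W)` with `W`-independent kernel and a `W`-independent port source `g`,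
`W ↦ ⟨g, 𝕄₀(W)⁺ g⟩` constant on `SU(3)^{links}` ⇒ `(𝕄₀(W)⁺ g)(x) ≡ 0` or `(𝕄₀(W)⁺ g)(y) ≡ 0`
(by Feynman–Hellmann, constancy kills the symmetrised colour current of the response field on every
link for every `W`).  Why it might fail: a port datum and source for which that matrix element IS
`W`-constant with non-zero transmission (then (MS), the exterior-uniform fibre moment S⁺ and this whole
line are false, while the exterior-AVERAGED crux survives — STRATEGY-CENSUS §Negation 2). -/
theorem stub_cubeMeanSquareDominationNonreal :
    (∀ (L : ℕ) [NeZero L], 4 ≤ L → ∀ (m₀ : ℝ) (z : ℂ) (x y : TorusSite 4 L)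
      (U : GaugeConfig 4 L SU3) (h : TorusSite 4 L × Fin 3 × Fin 4 → ℂ),
      (∀ W W' : GaugeConfig 4 L SU3,
        (hz (refit (touches x y) U W) m₀ z) *ᵥ h = (hz (refit (touches x y) U W') m₀ z) *ᵥ h) →
      ∀ c : TorusSite 4 L, (inCube x c = true ∨ inCube y c = true) →
      ∀ (a : Fin 3) (i : Fin 4), h (c, a, i) = 0) →
    (∀ (L : ℕ) [NeZero L], 4 ≤ L → ∀ (m₀ : ℝ) (z : ℂ), z.im ≠ 0 →
      ∀ (x y : TorusSite 4 L) (U : GaugeConfig 4 L SU3),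
      ∃ (c : ℂ) (S : Matrix (TorusSite 4 L × Fin 3 × Fin 4) (TorusSite 4 L × Fin 3 × Fin 4) ℂ),
        c ≠ 0 ∧
        (∀ p q, S p q ≠ 0 →
          ((∃ e : Edge 4 L, touches x y e = true ∧ (p.1 = e.1 ∨ p.1 = Site.shift e.1 e.2)) ∧
              ¬ (inCube x p.1 = true ∨ inCube y p.1 = true)) ∧
          ((∃ e : Edge 4 L, touches x y e = true ∧ (q.1 = e.1 ∨ q.1 = Site.shift e.1 e.2)) ∧
              ¬ (inCube x q.1 = true ∨ inCube y q.1 = true))) ∧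
        (∀ v : TorusSite 4 L × Fin 3 × Fin 4 → ℂ, 0 ≤ z.im * (star v ⬝ᵥ (S *ᵥ v)).im) ∧
        ∀ W : GaugeConfig 4 L SU3,
          (hz (refit (touches x y) U W) m₀ z).det =
            c * (Matrix.of (fun p q : TorusSite 4 L × Fin 3 × Fin 4 =>
                if (∃ e : Edge 4 L, touches x y e = true ∧ (p.1 = e.1 ∨ p.1 = Site.shift e.1 e.2)) ∧
                    (∃ e : Edge 4 L, touches x y e = true ∧ (q.1 = e.1 ∨ q.1 = Site.shift e.1 e.2))
                then (hz (refit (touches x y) U W) m₀ z) p q else if p = q then 1 else 0) - S).det ∧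
          ∀ (a : Fin 3) (i : Fin 4) (b : Fin 3) (j : Fin 4),
            (hz (refit (touches x y) U W) m₀ z).adjugate (x, a, i) (y, b, j) =
              c * (Matrix.of (fun p q : TorusSite 4 L × Fin 3 × Fin 4 =>
                if (∃ e : Edge 4 L, touches x y e = true ∧ (p.1 = e.1 ∨ p.1 = Site.shift e.1 e.2)) ∧
                    (∃ e : Edge 4 L, touches x y e = true ∧ (q.1 = e.1 ∨ q.1 = Site.shift e.1 e.2))
                then (hz (refit (touches x y) U W) m₀ z) p q else if p = q then 1 else 0) - S).adjugate
                (x, a, i) (y, b, j)) →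
    ∃ C₂ : ℝ, 0 < C₂ ∧ ∀ (L : ℕ) [NeZero L], 4 ≤ L →
      ∀ (m₀ : ℝ), -2 ≤ m₀ → m₀ ≤ 2 → ∀ (z : ℂ), z.im ≠ 0 → ‖z‖ ≤ 1 → ∀ (x y : TorusSite 4 L)
      (U : GaugeConfig 4 L SU3),
      ∫ W, (∑ a : Fin 3, ∑ i : Fin 4, ∑ b : Fin 3, ∑ j : Fin 4,
          ‖(hz (refit (touches x y) U W) m₀ z).adjugate (x, a, i) (y, b, j)‖) ^ 2 ∂(haarPi L) ≤
        C₂ * ∫ W, ‖(hz (refit (touches x y) U W) m₀ z).det‖ ^ 2 ∂(haarPi L) := by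
  sorry

/-- ASSEMBLY of the mean-square domination (MS) — the statement consumed by the landed reduction
`frameAPrioriBound_of_cubeMeanSquareDomination` — from the four stubs: order-zero rigidity and the port reduction feed the
load-bearing non-real statement, continuity in `z` extends it to the closed disc.  Real term. -/
theorem cubeMeanSquareDomination : ∃ C₂ : ℝ, 0 < C₂ ∧ ∀ (L : ℕ) [NeZero L], 4 ≤ L →
    ∀ (m₀ : ℝ), -2 ≤ m₀ → m₀ ≤ 2 → ∀ (z : ℂ), ‖z‖ ≤ 1 → ∀ (x y : TorusSite 4 L)
    (U : GaugeConfig 4 L SU3),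
    ∫ W, (∑ a : Fin 3, ∑ i : Fin 4, ∑ b : Fin 3, ∑ j : Fin 4,
        ‖(hz (refit (touches x y) U W) m₀ z).adjugate (x, a, i) (y, b, j)‖) ^ 2 ∂(haarPi L) ≤
      C₂ * ∫ W, ‖(hz (refit (touches x y) U W) m₀ z).det‖ ^ 2 ∂(haarPi L) :=
  stub_meanSquareOfNonreal (stub_cubeMeanSquareDominationNonreal stub_blindVanish stub_portReduction)

/-- COMPOSITION (the registered skeleton theorem): the assembled (MS), fed to the LANDED reduction
`frameAPrioriBound_of_cubeMeanSquareDomination` (five landed stubs + glue, p169125), proves the crux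
`GaussianLinkFrames.FrameAPrioriBound` BY NAME.  The only `sorry` is inside `stub_cubeMeanSquareDominationNonreal`. -/
theorem FrameAPrioriBound_of :
    Summit.QuantumFields.QCD.Theses.GaussianLinkFrames.FrameAPrioriBound :=
  frameAPrioriBound_of_cubeMeanSquareDomination cubeMeanSquareDomination

end Summit.QuantumFields.QCD.Cruxes.FrameAPrioriBound.CubeCofactor

end
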